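import Literature.NumberTheory.GaloisRepresentations.WeilDeligneOfGalois
import Literature.NumberTheory.GaloisRepresentations.WeilGroupFrobeniusPowers
import Literature.NumberTheory.GaloisRepresentations.WeilDeligneOfGaloisUnramifiedProofs
import Literature.NumberTheory.GaloisRepresentations.GaloisRep
import Literature.RepresentationTheory.Semisimple.BurnsideMatrixSpan
import Literature.LinearAlgebra.BaseChange.LinearIndependentFieldExtension
import Literature.LinearAlgebra.Matrix.NilpotentExpInjective
import Summits.Langlands.Langlands.Theorems.IrreducibilityBySelfDualityIrreducibleOffSectorWDIrreducibleBasics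
import HarnessLib

/-!
# L3: irreducibility of a Weil–Deligne representation descends along transport of coefficients
(crux stmt-Langlands-14329 `IrreducibilityBySelfDuality.IrreducibleOffSector`, supports kit
`square-integrable-place` §1; `--supports` file; STRUCTURAL: Literature imports only)

If `Wℂ = ι(W)` (`IsTransportAlong ι W Wℂ`: matrices moved entrywise along `ι : ℚ̄_ℓ →+* ℂ`) and
`Wℂ` is irreducible, then `W` is irreducible.  Proof via Burnside: `Wℂ` irreducible ⇒ the
matrices `[Wℂ.ρ w] = [W.ρ w].map ι` span `M_n(ℂ)` (`span_toMatrix'_eq_top_of_isIrreducible`) ⇒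
the `[W.ρ w]` span `M_n(ℚ̄_ℓ)` (`Literature.RepresentationTheory.Semisimple.span_range_map_eq_top_iff`)
⇒ `W` irreducible (`isIrreducible_of_span_toMatrix'_eq_top`).
Reference: Deligne, Antwerp II §8.4.3; Curtis–Reiner (27.4), (29.13).
-/

noncomputable section

set_option linter.dupNamespace false

open scoped MatrixGroups Matrix NumberField
open Module IsDedekindDomain
open Literature.NumberTheory.GaloisRepresentations
open Literature.NumberTheory.GaloisRepresentations.WeilGroup

namespace Summit.Langlands.Langlands.Theorems.IrreducibleOffSector.SquareIntegrablePlace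


/-- **L3 (descent along `ι`).** Irreducibility descends along transport of coefficients `Wℂ = ι(W)`
(`ι : ℚ̄_ℓ →+* ℂ` injective). [cite: DeligneAntwerpII1973, §8.4.3] -/
theorem isIrreducible_of_isTransportAlong {F : Type} [Field F] [ValuativeRel F]
    [TopologicalSpace F] [IsNonarchimedeanLocalField F] {ℓ n : ℕ} [Fact ℓ.Prime]
    (ι : PadicAlgCl ℓ →+* ℂ) (W : WeilDeligneRep F (PadicAlgCl ℓ) (Fin n → PadicAlgCl ℓ))
    (Wℂ : WeilDeligneRep F ℂ (Fin n → ℂ)) (ht : W.IsTransportAlong ι Wℂ) (h : Wℂ.IsIrreducible) :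
    W.IsIrreducible := by
  have hn : 0 < n := pos_of_isIrreducible h
  -- Burnside over `ℂ`: the matrices of `Wℂ.ρ` span `M_n(ℂ)`
  have hspan := span_toMatrix'_eq_top_of_isIrreducible h
  -- they are the `ι`-images of the matrices of `W.ρ`
  have hfun : (fun w => LinearMap.toMatrix' (Wℂ.ρ w)) =
      fun w => (LinearMap.toMatrix' (W.ρ w)).map ι := funext fun w => ht.1 w
  rw [hfun, Literature.RepresentationTheory.Semisimple.span_range_map_eq_top_iff] at hspan
  exact isIrreducible_of_span_toMatrix'_eq_top hn hspan

end Summit.Langlands.Langlands.Theorems.IrreducibleOffSector.SquareIntegrablePlace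

end
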